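import Summits.Ventures.LatticeQCDFlow.Scoring.TorusFreeEnergyDensity2DAllN
import Summits.Ventures.LatticeQCDFlow.Scoring.OnePlaquetteHaarMGF
import Literature.MathematicalPhysics.QuantumLattice.LatticeGaugeDLR
import HarnessLib

/-!
# The free energy density of two-dimensional lattice Yang–Mills at EVERY real `β`: `f(β) = log z₁(β)` is the one-plaquette cumulant generating function — REAL-ANALYTIC AND CONVEX ON `ℝ`

HONEST FRAMING: exact (Metropolis-corrected) sampling algorithms for lattice gauge theory;
figures of merit are autocorrelation/cost numbers at stated couplings and volumes; no
continuum-physics claim.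

Venture `LatticeQCDFlow` (cell pub-lqcd), sub-topic `Scoring`; FANOUT row 5 (`s0-sun-a`), GEN-19.
NEW WORK of the cell (placement rule).  GEN-16/17 (`TorusFreeEnergyDensity2D`, `…AllN`) typed the sandwich
`e^{−βs} z₁^{L²−1} ≤ Z_{(ℤ/L)²}(β) ≤ z₁^{L²−1}` and the limit `log Z/L² → log z₁(β)` for `β ≥ 0` under the
hypotheses `Re tr ρ ≤ N`, `N − Re tr ρ ≤ s`.  Here, for EVERY compact metrisable `G`, EVERY continuous
`ρ : G →* M_N(ℂ)` and EVERY REAL `β` (no hypothesis on `ρ`: `|Re tr ρ| ≤ N` is the tree's unitary trick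
`CompactGroup.abs_re_trace_le_card`), in the vocabulary of the Literature's DLR file
(`Literature.MathematicalPhysics.QuantumLattice.HasFreeEnergyDensity / freeEnergyDensity`, S17):

* §1 `oneWeight_mem_Icc` (`e^{−2N|β|} ≤ e^{−β(N − Re tr ρ)} ≤ e^{2N|β|}`), `ofReal_le_z1`, `z1_le_ofReal`,
  `z1_toReal_eq_integral`, **`z1_toReal_eq_mgf`** (`z₁(β) = mgf_{Haar}(Re tr ρ − N)(β)`), `log_z1_toReal_eq_cgf`;
* §2 `partitionFunction_two_mem_Icc_ennreal` / `partitionFunction_two_toReal_mem_Icc`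
  (`e^{−2N|β|} z₁^{L²−1} ≤ Z_{(ℤ/L)²}(β) ≤ e^{2N|β|} z₁^{L²−1}`, EVERY real `β`, `L ≥ 2` — row 30's punctured
  independence `lintegral_prod_weight_erase`), `abs_log_partitionFunction_two_sub_le`
  (`|log Z − (L²−1) log z₁| ≤ 2N|β|`), `abs_log_partitionFunction_two_div_sub_le` (`|log Z/L² − log z₁| ≤ (2N|β| + |log z₁|)/L²`);
* §3 **`hasFreeEnergyDensity_two : HasFreeEnergyDensity 2 ρ β (log z₁(β))` FOR EVERY REAL `β`**,
  **`freeEnergyDensity_two_eq`** (`freeEnergyDensity 2 ρ β = log z₁(β) = cgf_{Haar}(Re tr ρ − N)(β)`),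
  **`analyticOnNhd_freeEnergyDensity_two`** — THE FREE ENERGY DENSITY IS REAL-ANALYTIC ON ALL OF `ℝ`: NO THERMODYNAMIC
  PHASE TRANSITION OF ANY ORDER IN TWO DIMENSIONS, for every compact gauge group and every continuous `ρ` —,
  **`convexOn_freeEnergyDensity_two`**, **`hasDerivAt_freeEnergyDensity_two`** (`f′(β) = ⟨Re tr ρ − N⟩_{tilted}`: minus the
  mean plaquette action in the one-plaquette law `e^{−β(N − Re tr ρ)} dHaar / z₁`, which by GEN-19 (24) IS the plaquette
  law of the infinite-volume state), `iteratedDeriv_two_freeEnergyDensity_two` (`f″(β)` = the tilted variance ≥ 0: the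
  specific heat per plaquette);
* §4 `U(N)` (every `N`) and `SU(N)` (every `N ≥ 1`), EVERY REAL `β` (GEN-17 had `β ≥ 0`):
  **`hasFreeEnergyDensity_two_unitary`** (`f = −Nβ + log det[I_{|i−j|}(β)]_{N×N}`), `freeEnergyDensity_two_unitary_eq`,
  **`analyticOnNhd_unitary_freeEnergy_two`**; **`hasFreeEnergyDensity_two_specialUnitary`**
  (`f = −Nβ + log Σ_{q∈ℤ} det[I_{|q+i−j|}(β)]`), `freeEnergyDensity_two_specialUnitary_eq`,
  **`analyticOnNhd_specialUnitary_freeEnergy_two`** (in particular `β ↦ log Σ_q det[I_{|q+i−j|}(β)]` is real-analytic on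
  `ℝ`).  At every FINITE `N` the `U(N)` free energy is analytic in `β`; the Gross–Witten third-order transition is a
  statement about the `N → ∞` limit only (cf. `Literature/Barriers/QuantumFields/GrossWitten*`).

No `def`, nothing cited as a fact, 0 sorry.  Elementary given the tree (row 30's punctured independence, GEN-17's
bounded-observable `mgf/cgf` calculus, the Literature's unitary trick and DLR vocabulary).
-/

noncomputable section

open Real MeasureTheory ProbabilityTheory Filter Topology
open Literature.MathematicalPhysics.QuantumFieldTheory
open Literature.MathematicalPhysics.QuantumLattice (fundamentalRep unitaryFundamentalRep continuous_fundamentalRep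
  continuous_unitaryFundamentalRep)
open Literature.Analysis.FunctionSpaces (besselI)
open Literature.RepresentationTheory.CompactGroups
open Summit.Ventures.LatticeQCDFlow.Theory2.Lattice
open Summit.Ventures.LatticeQCDFlow.Theory2.Lattice.TwoDim

namespace Summit.Ventures.LatticeQCDFlow.Scoring

variable {N : ℕ} {G : Type*} [Group G] [TopologicalSpace G] [IsTopologicalGroup G] [CompactSpace G]
  [SecondCountableTopology G] [MeasurableSpace G] [BorelSpace G] (ρ : G →* Matrix (Fin N) (Fin N) ℂ)

/-! ### 1. The one-plaquette integral `z₁(β)` at every real `β` -/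

omit [SecondCountableTopology G] [MeasurableSpace G] [BorelSpace G] in
/-- Pointwise bounds on the one-plaquette weight, every real `β`: `e^{−2N|β|} ≤ e^{−β(N − Re tr ρ(g))} ≤ e^{2N|β|}`
(`|Re tr ρ| ≤ N` by the unitary trick). -/
theorem oneWeight_mem_Icc (hρ : Continuous ρ) (β : ℝ) (g : G) :
    Real.exp (-(2 * N * |β|)) ≤ Real.exp (-(β * ((N : ℝ) - (ρ g).trace.re))) ∧
      Real.exp (-(β * ((N : ℝ) - (ρ g).trace.re))) ≤ Real.exp (2 * N * |β|) := by
  have h := CompactGroup.abs_re_trace_le_card ρ hρ g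
  rw [Fintype.card_fin] at h
  have hN : (0 : ℝ) ≤ N := Nat.cast_nonneg N
  have h2 : |((N : ℝ) - (ρ g).trace.re)| ≤ 2 * N := by
    rw [abs_le] at h ⊢
    constructor <;> linarith [h.1, h.2]
  have h1 : |β * ((N : ℝ) - (ρ g).trace.re)| ≤ 2 * N * |β| := by
    rw [abs_mul]
    calc |β| * |((N : ℝ) - (ρ g).trace.re)| ≤ |β| * (2 * N) :=
          mul_le_mul_of_nonneg_left h2 (abs_nonneg _)
      _ = 2 * N * |β| := by ring
  obtain ⟨hl, hu⟩ := abs_le.1 h1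
  exact ⟨Real.exp_le_exp.2 (by linarith), Real.exp_le_exp.2 (by linarith)⟩

omit [SecondCountableTopology G] in
/-- `z₁(β) ≥ e^{−2N|β|}` for every real `β`. -/
theorem ofReal_le_z1 (hρ : Continuous ρ) (β : ℝ) :
    ENNReal.ofReal (Real.exp (-(2 * N * |β|))) ≤ z1 ρ β := by
  unfold z1
  calc ENNReal.ofReal (Real.exp (-(2 * N * |β|)))
      = ∫⁻ _, ENNReal.ofReal (Real.exp (-(2 * N * |β|))) ∂(haarProbability G) := by
        rw [lintegral_const, measure_univ, mul_one]
    _ ≤ _ := lintegral_mono fun g => ENNReal.ofReal_le_ofReal (oneWeight_mem_Icc ρ hρ β g).1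

omit [SecondCountableTopology G] in
/-- `z₁(β) ≤ e^{2N|β|}` for every real `β` (so `z₁(β) < ∞`). -/
theorem z1_le_ofReal (hρ : Continuous ρ) (β : ℝ) :
    z1 ρ β ≤ ENNReal.ofReal (Real.exp (2 * N * |β|)) := by
  unfold z1
  calc _ ≤ ∫⁻ _, ENNReal.ofReal (Real.exp (2 * N * |β|)) ∂(haarProbability G) :=
        lintegral_mono fun g => ENNReal.ofReal_le_ofReal (oneWeight_mem_Icc ρ hρ β g).2
    _ = _ := by rw [lintegral_const, measure_univ, mul_one]

omit [SecondCountableTopology G] in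
/-- `z₁(β)` as a Bochner integral: `z₁(β).toReal = ∫ e^{−β(N − Re tr ρ)} dHaar`. -/
theorem z1_toReal_eq_integral (hρ : Continuous ρ) (β : ℝ) :
    (z1 ρ β).toReal = ∫ g, Real.exp (-(β * ((N : ℝ) - (ρ g).trace.re))) ∂(haarProbability G) := by
  have hc : Continuous fun g : G => Real.exp (-(β * ((N : ℝ) - (ρ g).trace.re))) := by
    have := Complex.continuous_re.comp hρ.matrix_trace
    fun_prop
  rw [z1, integral_eq_lintegral_of_nonneg_ae (ae_of_all _ fun g => (Real.exp_pos _).le)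
    hc.aestronglyMeasurable]

omit [SecondCountableTopology G] in
/-- **`z₁(β)` is the moment generating function of `Re tr ρ − N` under Haar measure**:
`z₁(β).toReal = mgf_{Haar}(Re tr ρ − N)(β)`. -/
theorem z1_toReal_eq_mgf (hρ : Continuous ρ) (β : ℝ) :
    (z1 ρ β).toReal = mgf (fun g : G => (ρ g).trace.re - N) (haarProbability G) β := by
  rw [z1_toReal_eq_integral ρ hρ β, mgf]
  refine integral_congr_ae (ae_of_all _ fun g => ?_)
  simp only
  congr 1
  ring

omit [SecondCountableTopology G] in
/-- `log z₁(β) = cgf_{Haar}(Re tr ρ − N)(β)`, the one-plaquette cumulant generating function. -/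
theorem log_z1_toReal_eq_cgf (hρ : Continuous ρ) (β : ℝ) :
    Real.log (z1 ρ β).toReal = cgf (fun g : G => (ρ g).trace.re - N) (haarProbability G) β := by
  rw [cgf, z1_toReal_eq_mgf ρ hρ β]

/-! ### 2. The torus partition function at every real `β`: `Z = z₁^{L²−1}` up to one plaquette weight -/

/-- **The two-dimensional sandwich at every real `β`** (in `ℝ≥0∞`): for `L ≥ 2`,
`e^{−2N|β|} z₁(β)^{L²−1} ≤ Z_{(ℤ/L)²}(β) ≤ e^{2N|β|} z₁(β)^{L²−1}` — off one puncture the plaquettes are independent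
Haar variables (row 30), and the punctured plaquette's weight lies in `[e^{−2N|β|}, e^{2N|β|}]`. -/
theorem partitionFunction_two_mem_Icc_ennreal {L : ℕ} [NeZero L] (hL : 2 ≤ L) (hρ : Continuous ρ) (β : ℝ) :
    ENNReal.ofReal (Real.exp (-(2 * N * |β|))) * z1 ρ β ^ (L ^ 2 - 1) ≤
        partitionFunction (d := 2) (L := L) ρ β ∧
      partitionFunction (d := 2) (L := L) ρ β ≤
        ENNReal.ofReal (Real.exp (2 * N * |β|)) * z1 ρ β ^ (L ^ 2 - 1) := by
  have hP : Measurable fun U : GaugeConfig 2 L G => ∏ x ∈ Finset.univ.erase (0 : Site 2 L),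
      ENNReal.ofReal (Real.exp (-(β * ((N : ℝ) - (ρ (plaquetteHolonomy U x 0 1)).trace.re)))) :=
    Finset.measurable_prod _ fun x _ =>
      (measurable_oneWeight ρ hρ β).comp (measurable_plaquetteHolonomy x)
  unfold partitionFunction wilsonWeight
  rw [withDensity_apply _ MeasurableSet.univ, Measure.restrict_univ,
    ← lintegral_prod_weight_erase ρ hL 0 hρ β, ← lintegral_const_mul _ hP, ← lintegral_const_mul _ hP]
  constructor
  · refine lintegral_mono fun U => ?_
    rw [weight_eq_prod_two ρ β U, ← Finset.prod_erase_mul _ _ (Finset.mem_univ (0 : Site 2 L))]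
    exact (mul_le_mul_left (ENNReal.ofReal_le_ofReal (oneWeight_mem_Icc ρ hρ β _).1) _).trans_eq
      (mul_comm _ _)
  · refine lintegral_mono fun U => ?_
    rw [weight_eq_prod_two ρ β U, ← Finset.prod_erase_mul _ _ (Finset.mem_univ (0 : Site 2 L))]
    exact (mul_comm _ _).trans_le
      (mul_le_mul_left (ENNReal.ofReal_le_ofReal (oneWeight_mem_Icc ρ hρ β _).2) _)

/-- **The sandwich in real numbers, every real `β`**: `e^{−2N|β|} z₁^{L²−1} ≤ Z_{(ℤ/L)²}(β) ≤ e^{2N|β|} z₁^{L²−1}` and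
`0 < z₁(β)` (as reals; all quantities are finite). -/
theorem partitionFunction_two_toReal_mem_Icc {L : ℕ} [NeZero L] (hL : 2 ≤ L) (hρ : Continuous ρ) (β : ℝ) :
    Real.exp (-(2 * N * |β|)) * (z1 ρ β).toReal ^ (L ^ 2 - 1) ≤
        (partitionFunction (d := 2) (L := L) ρ β).toReal ∧
      (partitionFunction (d := 2) (L := L) ρ β).toReal ≤
        Real.exp (2 * N * |β|) * (z1 ρ β).toReal ^ (L ^ 2 - 1) ∧
      0 < (z1 ρ β).toReal := by
  have hz_ne : z1 ρ β ≠ ⊤ := ne_top_of_le_ne_top ENNReal.ofReal_ne_top (z1_le_ofReal ρ hρ β)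
  obtain ⟨hlo, hup⟩ := partitionFunction_two_mem_Icc_ennreal ρ hL hρ β
  have hpow_ne : z1 ρ β ^ (L ^ 2 - 1) ≠ ⊤ := ENNReal.pow_ne_top hz_ne
  have hs_ne : ENNReal.ofReal (Real.exp (2 * N * |β|)) * z1 ρ β ^ (L ^ 2 - 1) ≠ ⊤ :=
    ENNReal.mul_ne_top ENNReal.ofReal_ne_top hpow_ne
  have hZ_ne : partitionFunction (d := 2) (L := L) ρ β ≠ ⊤ := ne_top_of_le_ne_top hs_ne hup
  refine ⟨?_, ?_, ?_⟩
  · have h := ENNReal.toReal_mono hZ_ne hlo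
    rwa [ENNReal.toReal_mul, ENNReal.toReal_ofReal (Real.exp_pos _).le, ENNReal.toReal_pow] at h
  · have h := ENNReal.toReal_mono hs_ne hup
    rwa [ENNReal.toReal_mul, ENNReal.toReal_ofReal (Real.exp_pos _).le, ENNReal.toReal_pow] at h
  · have h := ENNReal.toReal_mono hz_ne (ofReal_le_z1 ρ hρ β)
    rw [ENNReal.toReal_ofReal (Real.exp_pos _).le] at h
    exact lt_of_lt_of_le (Real.exp_pos _) h

/-- **The free energy is extensive up to one plaquette, every real `β`**: `|log Z_{(ℤ/L)²}(β) − (L² − 1) log z₁(β)| ≤ 2N|β|`. -/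
theorem abs_log_partitionFunction_two_sub_le {L : ℕ} [NeZero L] (hL : 2 ≤ L) (hρ : Continuous ρ) (β : ℝ) :
    |Real.log (partitionFunction (d := 2) (L := L) ρ β).toReal -
        ((L ^ 2 - 1 : ℕ) : ℝ) * Real.log (z1 ρ β).toReal| ≤ 2 * N * |β| := by
  obtain ⟨hlo, hup, hz0⟩ := partitionFunction_two_toReal_mem_Icc ρ hL hρ β
  have hpow : 0 < (z1 ρ β).toReal ^ (L ^ 2 - 1) := pow_pos hz0 _
  have hZ0 : 0 < (partitionFunction (d := 2) (L := L) ρ β).toReal :=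
    lt_of_lt_of_le (mul_pos (Real.exp_pos _) hpow) hlo
  rw [abs_le]
  constructor
  · have h := Real.log_le_log (mul_pos (Real.exp_pos _) hpow) hlo
    rw [Real.log_mul (Real.exp_pos _).ne' hpow.ne', Real.log_exp, Real.log_pow] at h
    linarith
  · have h := Real.log_le_log hZ0 hup
    rw [Real.log_mul (Real.exp_pos _).ne' hpow.ne', Real.log_exp, Real.log_pow] at h
    linarith

/-- **Finite-size bound for the free energy density, every real `β`**:
`|log Z_{(ℤ/L)²}(β)/L² − log z₁(β)| ≤ (2N|β| + |log z₁(β)|)/L²` for `L ≥ 2`. -/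
theorem abs_log_partitionFunction_two_div_sub_le {L : ℕ} [NeZero L] (hL : 2 ≤ L) (hρ : Continuous ρ)
    (β : ℝ) :
    |Real.log (partitionFunction (d := 2) (L := L) ρ β).toReal / ((L : ℝ) ^ 2) - Real.log (z1 ρ β).toReal| ≤
      (2 * N * |β| + |Real.log (z1 ρ β).toReal|) / ((L : ℝ) ^ 2) := by
  have h := abs_log_partitionFunction_two_sub_le ρ hL hρ β
  have hL0 : (0 : ℝ) < (L : ℝ) ^ 2 := by positivity
  have hcast : ((L ^ 2 - 1 : ℕ) : ℝ) = (L : ℝ) ^ 2 - 1 := by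
    rw [Nat.cast_sub (Nat.one_le_pow _ _ (by omega)), Nat.cast_pow, Nat.cast_one]
  rw [hcast] at h
  have key : Real.log (partitionFunction (d := 2) (L := L) ρ β).toReal / ((L : ℝ) ^ 2) -
      Real.log (z1 ρ β).toReal =
      ((Real.log (partitionFunction (d := 2) (L := L) ρ β).toReal - ((L : ℝ) ^ 2 - 1) * Real.log (z1 ρ β).toReal) -
        Real.log (z1 ρ β).toReal) / ((L : ℝ) ^ 2) := by
    field_simp
    ring
  rw [key, abs_div, abs_of_pos hL0, div_le_div_iff_of_pos_right hL0]
  exact (abs_sub _ _).trans (by linarith)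

/-! ### 3. The free energy density at every real `β`: value, analyticity, convexity, derivatives -/

/-- **THE FREE ENERGY DENSITY OF TWO-DIMENSIONAL LATTICE YANG–MILLS EXISTS AT EVERY REAL `β` AND EQUALS `log z₁(β)`**
(Literature vocabulary `HasFreeEnergyDensity`, S17): `(L+1)⁻² log Z_{(ℤ/(L+1))²}(β) → log z₁(β)`, for every compact
metrisable `G` and every continuous `ρ`. -/
theorem hasFreeEnergyDensity_two (hρ : Continuous ρ) (β : ℝ) :
    Literature.MathematicalPhysics.QuantumLattice.HasFreeEnergyDensity 2 ρ β (Real.log (z1 ρ β).toReal) := by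
  unfold Literature.MathematicalPhysics.QuantumLattice.HasFreeEnergyDensity
    Literature.MathematicalPhysics.QuantumLattice.torusLogPartition
  have h1 : Tendsto (fun L : ℕ => (((L + 1 : ℕ) : ℝ))) atTop atTop :=
    tendsto_natCast_atTop_atTop.comp (tendsto_add_atTop_nat 1)
  have h2 : Tendsto (fun L : ℕ => (((L + 1 : ℕ) : ℝ)) ^ 2) atTop atTop :=
    (tendsto_pow_atTop two_ne_zero).comp h1
  have hC : Tendsto (fun L : ℕ => (2 * N * |β| + |Real.log (z1 ρ β).toReal|) / ((((L + 1 : ℕ) : ℝ)) ^ 2))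
      atTop (𝓝 0) := tendsto_const_nhds.div_atTop h2
  rw [← tendsto_sub_nhds_zero_iff]
  refine squeeze_zero_norm' (Filter.eventually_atTop.2 ⟨1, fun L hL => ?_⟩) hC
  rw [Real.norm_eq_abs, inv_mul_eq_div]
  exact abs_log_partitionFunction_two_div_sub_le ρ (L := L + 1) (by omega) hρ β

/-- **`freeEnergyDensity 2 ρ β = log z₁(β)`** for every real `β`. -/
theorem freeEnergyDensity_two_eq (hρ : Continuous ρ) (β : ℝ) :
    Literature.MathematicalPhysics.QuantumLattice.freeEnergyDensity 2 ρ β = Real.log (z1 ρ β).toReal :=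
  (hasFreeEnergyDensity_two ρ hρ β).freeEnergyDensity_eq

/-- The free energy density as a function of `β` IS the one-plaquette cumulant generating function
`cgf_{Haar}(Re tr ρ − N)`. -/
theorem freeEnergyDensity_two_eq_cgf (hρ : Continuous ρ) :
    (fun β => Literature.MathematicalPhysics.QuantumLattice.freeEnergyDensity 2 ρ β) =
      cgf (fun g : G => (ρ g).trace.re - N) (haarProbability G) := by
  funext β
  rw [freeEnergyDensity_two_eq ρ hρ β, log_z1_toReal_eq_cgf ρ hρ β]

omit [SecondCountableTopology G] in
/-- The observable `Re tr ρ − N` is bounded by `2N` and a.e.-strongly measurable under Haar measure. -/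
theorem abs_trace_re_sub_le (hρ : Continuous ρ) :
    AEStronglyMeasurable (fun g : G => (ρ g).trace.re - N) (haarProbability G) ∧
      ∀ g : G, |(ρ g).trace.re - N| ≤ 2 * N := by
  refine ⟨((Complex.continuous_re.comp hρ.matrix_trace).sub continuous_const).aestronglyMeasurable,
    fun g => ?_⟩
  have h := CompactGroup.abs_re_trace_le_card ρ hρ g
  rw [Fintype.card_fin] at h
  have hN : (0 : ℝ) ≤ N := Nat.cast_nonneg N
  rw [abs_le] at h ⊢
  constructor <;> linarith [h.1, h.2]

/-- **NO THERMODYNAMIC PHASE TRANSITION IN TWO DIMENSIONS**: for every compact metrisable gauge group and every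
continuous `ρ`, the free energy density `β ↦ freeEnergyDensity 2 ρ β` is REAL-ANALYTIC ON ALL OF `ℝ`. -/
theorem analyticOnNhd_freeEnergyDensity_two (hρ : Continuous ρ) :
    AnalyticOnNhd ℝ (fun β => Literature.MathematicalPhysics.QuantumLattice.freeEnergyDensity 2 ρ β)
      Set.univ := by
  rw [freeEnergyDensity_two_eq_cgf ρ hρ]
  exact analyticOnNhd_cgf_univ (abs_trace_re_sub_le ρ hρ).1 (abs_trace_re_sub_le ρ hρ).2

/-- **The free energy density is convex in `β` on `ℝ`.** -/
theorem convexOn_freeEnergyDensity_two (hρ : Continuous ρ) :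
    ConvexOn ℝ Set.univ (fun β => Literature.MathematicalPhysics.QuantumLattice.freeEnergyDensity 2 ρ β) := by
  rw [freeEnergyDensity_two_eq_cgf ρ hρ]
  exact convexOn_cgf_univ (abs_trace_re_sub_le ρ hρ).1 (abs_trace_re_sub_le ρ hρ).2

/-- **The first derivative of the free energy density**: `f′(β) = ∫ (Re tr ρ − N) e^{β(Re tr ρ − N)} dHaar / z₁(β)`,
the mean of `Re tr ρ − N` (minus the plaquette action) in the one-plaquette tilted law `e^{−β(N − Re tr ρ)} dHaar/z₁(β)`. -/
theorem hasDerivAt_freeEnergyDensity_two (hρ : Continuous ρ) (β : ℝ) :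
    HasDerivAt (fun β => Literature.MathematicalPhysics.QuantumLattice.freeEnergyDensity 2 ρ β)
      ((∫ g, ((ρ g).trace.re - N) * Real.exp (β * ((ρ g).trace.re - N)) ∂(haarProbability G)) /
        mgf (fun g : G => (ρ g).trace.re - N) (haarProbability G) β) β := by
  obtain ⟨hX, hB⟩ := abs_trace_re_sub_le ρ hρ
  have hint := mem_interior_integrableExpSet_of_abs_le_const hX hB β
  rw [freeEnergyDensity_two_eq_cgf ρ hρ, ← deriv_cgf hint]
  exact (analyticAt_cgf hint).differentiableAt.hasDerivAt

/-- **The second derivative of the free energy density is the tilted variance** (the specific heat per plaquette,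
`≥ 0`): `f″(β) = ∫ (X − f′(β))² e^{βX} dHaar / z₁(β)` with `X = Re tr ρ − N`. -/
theorem iteratedDeriv_two_freeEnergyDensity_two (hρ : Continuous ρ) (β : ℝ) :
    iteratedDeriv 2 (fun β => Literature.MathematicalPhysics.QuantumLattice.freeEnergyDensity 2 ρ β) β =
      (∫ g, (((ρ g).trace.re - N) -
          deriv (cgf (fun g : G => (ρ g).trace.re - N) (haarProbability G)) β) ^ 2 *
          Real.exp (β * ((ρ g).trace.re - N)) ∂(haarProbability G)) /
        mgf (fun g : G => (ρ g).trace.re - N) (haarProbability G) β ∧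
      0 ≤ iteratedDeriv 2 (fun β => Literature.MathematicalPhysics.QuantumLattice.freeEnergyDensity 2 ρ β) β := by
  obtain ⟨hX, hB⟩ := abs_trace_re_sub_le ρ hρ
  rw [freeEnergyDensity_two_eq_cgf ρ hρ]
  exact ⟨iteratedDeriv_two_cgf_eq_integral (mem_interior_integrableExpSet_of_abs_le_const hX hB β),
    iteratedDeriv_two_cgf_nonneg hX hB β⟩

/-! ### 4. `U(N)` and `SU(N)`: the free energy density at every real `β`, in Bessel form -/

/-- **THE FREE ENERGY DENSITY OF 2-d `U(N)` LATTICE YANG–MILLS, EVERY `N`, EVERY REAL `β`**: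
`(L+1)⁻² log Z^{U(N)}_{(ℤ/(L+1))²}(β) → −Nβ + log det[I_{|i−j|}(β)]_{i,j<N}`. -/
theorem hasFreeEnergyDensity_two_unitary (N : ℕ) (β : ℝ) :
    Literature.MathematicalPhysics.QuantumLattice.HasFreeEnergyDensity 2 (unitaryFundamentalRep (Fin N) ℂ) β
      (-(N * β) + Real.log (Matrix.of fun i j : Fin N => besselI ((i : ℤ) - (j : ℤ)).natAbs β).det) := by
  have h := hasFreeEnergyDensity_two (unitaryFundamentalRep (Fin N) ℂ) (continuous_unitaryFundamentalRep (Fin N) ℂ) β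
  rwa [log_z1_unitary_toReal] at h

/-- `freeEnergyDensity 2 ρ_{U(N)} β = −Nβ + log det[I_{|i−j|}(β)]` for every real `β`. -/
theorem freeEnergyDensity_two_unitary_eq (N : ℕ) (β : ℝ) :
    Literature.MathematicalPhysics.QuantumLattice.freeEnergyDensity 2 (unitaryFundamentalRep (Fin N) ℂ) β =
      -(N * β) + Real.log (Matrix.of fun i j : Fin N => besselI ((i : ℤ) - (j : ℤ)).natAbs β).det :=
  (hasFreeEnergyDensity_two_unitary N β).freeEnergyDensity_eq

/-- **At every finite `N` the `U(N)` free energy density `β ↦ −Nβ + log det[I_{|i−j|}(β)]` is real-analytic on `ℝ`**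
(no finite-`N` Gross–Witten transition). -/
theorem analyticOnNhd_unitary_freeEnergy_two (N : ℕ) :
    AnalyticOnNhd ℝ (fun β : ℝ =>
      -(N * β) + Real.log (Matrix.of fun i j : Fin N => besselI ((i : ℤ) - (j : ℤ)).natAbs β).det) Set.univ := by
  have h := analyticOnNhd_freeEnergyDensity_two (unitaryFundamentalRep (Fin N) ℂ)
    (continuous_unitaryFundamentalRep (Fin N) ℂ)
  have heq : (fun β : ℝ =>
      -(N * β) + Real.log (Matrix.of fun i j : Fin N => besselI ((i : ℤ) - (j : ℤ)).natAbs β).det) =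
      fun β => Literature.MathematicalPhysics.QuantumLattice.freeEnergyDensity 2 (unitaryFundamentalRep (Fin N) ℂ) β :=
    funext fun β => (freeEnergyDensity_two_unitary_eq N β).symm
  rw [heq]
  exact h

/-- **THE FREE ENERGY DENSITY OF 2-d `SU(N)` LATTICE YANG–MILLS, EVERY `N ≥ 1`, EVERY REAL `β`**:
`(L+1)⁻² log Z^{SU(N)}_{(ℤ/(L+1))²}(β) → −Nβ + log Σ_{q∈ℤ} det[I_{|q+i−j|}(β)]_{i,j<N}`. -/
theorem hasFreeEnergyDensity_two_specialUnitary (N : ℕ) [NeZero N] (β : ℝ) :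
    Literature.MathematicalPhysics.QuantumLattice.HasFreeEnergyDensity 2 (fundamentalRep (Fin N)) β
      (-(N * β) + Real.log (∑' q : ℤ, (Matrix.of fun i j : Fin N =>
        besselI (q + (i : ℤ) - (j : ℤ)).natAbs β).det)) := by
  have h := hasFreeEnergyDensity_two (fundamentalRep (Fin N)) (continuous_fundamentalRep (Fin N)) β
  rwa [log_z1_specialUnitary_toReal] at h

/-- `freeEnergyDensity 2 ρ_{SU(N)} β = −Nβ + log Σ_q det[I_{|q+i−j|}(β)]` for every real `β` (`N ≥ 1`). -/
theorem freeEnergyDensity_two_specialUnitary_eq (N : ℕ) [NeZero N] (β : ℝ) :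
    Literature.MathematicalPhysics.QuantumLattice.freeEnergyDensity 2 (fundamentalRep (Fin N)) β =
      -(N * β) + Real.log (∑' q : ℤ, (Matrix.of fun i j : Fin N =>
        besselI (q + (i : ℤ) - (j : ℤ)).natAbs β).det) :=
  (hasFreeEnergyDensity_two_specialUnitary N β).freeEnergyDensity_eq

/-- **At every `N ≥ 1` the `SU(N)` free energy density `β ↦ −Nβ + log Σ_q det[I_{|q+i−j|}(β)]` is real-analytic
on `ℝ`.** -/
theorem analyticOnNhd_specialUnitary_freeEnergy_two (N : ℕ) [NeZero N] :
    AnalyticOnNhd ℝ (fun β : ℝ => -(N * β) + Real.log (∑' q : ℤ, (Matrix.of fun i j : Fin N =>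
      besselI (q + (i : ℤ) - (j : ℤ)).natAbs β).det)) Set.univ := by
  have h := analyticOnNhd_freeEnergyDensity_two (fundamentalRep (Fin N)) (continuous_fundamentalRep (Fin N))
  have heq : (fun β : ℝ => -(N * β) + Real.log (∑' q : ℤ, (Matrix.of fun i j : Fin N =>
      besselI (q + (i : ℤ) - (j : ℤ)).natAbs β).det)) =
      fun β => Literature.MathematicalPhysics.QuantumLattice.freeEnergyDensity 2 (fundamentalRep (Fin N)) β :=
    funext fun β => (freeEnergyDensity_two_specialUnitary_eq N β).symm
  rw [heq]
  exact h

end Summit.Ventures.LatticeQCDFlow.Scoring
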